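import Literature.NumberTheory.EllipticCurves.NeronIsogenyScalingProofs
import HarnessLib

/-!
# The `ℚ`-isogeny of a rational lattice inclusion `cΛ₁ ⊆ Λ₂` is `z ↦ cz` on algebraic points

Topic `NumberTheory/EllipticCurves`; a proofs-only file (theorems only: no definitions, no named
facts, nothing restated; D-0026), sibling of `NeronIsogenyScalingProofs.lean` and
`AnalyticIsogenyDescentProofs.lean`.  For Weierstrass models `W₁, W₂/ℚ` (`W₁` elliptic) with
Néron-type period pairs `L₁, L₂` (`g₂ = c₄/12`, `g₃ = c₆/216`), complex uniformisations
`uᵢ : ℂ/Λᵢ ≅ Wᵢ(ℂ)` in the coordinates of the given models (Silverman, *AEC*, Prop. VI.3.6;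
the tree's `PeriodPair.exists_addMonoidHom_of_g₂_g₃'`) and `c ∈ ℚˣ` with `cΛ₁ ⊆ Λ₂`, the tree's
`Literature.NumberTheory.EllipticCurves.exists_isogeny_x_eq_of_forall_mul_mem_lattice` builds a
`ℚ`-isogeny `φ : W₁ → W₂` (Silverman, *AEC*, Thm. VI.4.1(b): `Hom(E₁, E₂) ≅ {α : αΛ₁ ⊆ Λ₂}`)
but exports only its `x`-coordinate `A(x)/B(x)` — which pins the analytic multiplier of `φ` up
to SIGN only, and says nothing about `φ` on the finitely many exceptional points.  This file
re-runs the construction with the uniformisations `u₁, u₂` as DATA and the embedding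
`j : ℚ̄ → ℂ` of the scalar tower `ℚ → ℚ̄ → ℂ` (the one `WeierstrassCurve.Isogeny.baseChange`
uses), and exports the analytic representation itself:

* `exists_isogeny_map_eq_uniformize_mul_of_forall_mul_mem_lattice` — **`j_*(φ m) = u₂(c z)`
  whenever `j_* m = u₁ z`** (`m ∈ W₁(ℚ̄)`, `z ∈ ℂ`): `φ` IS `z ↦ cz (mod Λ₂)` on algebraic points.

The consequences on all complex points (`φ_ℂ(u₁ z) = u₂(cz)`, `#ker φ_ℂ = deg φ = [Λ₂ : cΛ₁]`,
oddness of the degree when an odd multiple of `Λ₂` lies in `cΛ₁`) are drawn in the sibling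
`LatticeInclusionIsogenyDegreeProofs.lean`.  Nothing here is new mathematics: the body is the
tree's proof verbatim (descent of the transformation `℘_{c⁻¹Λ₂} = (P₀/Q₀)(℘_{Λ₁})` to `ℚ(X)`,
the analytic map `Φ = u₂ ∘ (c·) ∘ u₁⁻¹` preserving `j_* W₁(ℚ̄)` off a finite set hence
everywhere, algebraicity, `Γ_ℚ`-equivariance), with the identity `j_* ∘ φ = Φ ∘ j_*` that it
establishes on the way promoted to the conclusion.

## References

* [SilvermanAEC2009] J. H. Silverman, *The Arithmetic of Elliptic Curves*, 2nd ed., GTM 106,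
  Springer 2009: Thm. VI.4.1(b) (PDF pp. 152–154), Prop. VI.3.6(b), III.4.
-/

noncomputable section

open scoped Classical
open Complex Set Polynomial Filter Topology Bornology
open Literature.NumberTheory.EllipticCurves

namespace Literature.NumberTheory.EllipticCurves

open _root_.WeierstrassCurve _root_.PeriodPair

variable [Algebra (AlgebraicClosure ℚ) ℂ] [IsScalarTower ℚ (AlgebraicClosure ℚ) ℂ]

/-! ### The construction, with the analytic representation on algebraic points exported -/

/-- **The `ℚ`-isogeny of `cΛ₁ ⊆ Λ₂` is `z ↦ cz` on algebraic points.**  Let `W₁, W₂` be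
Weierstrass models over `ℚ` (`W₁` elliptic) with Néron-type period pairs `L₁, L₂`
(`g₂ = c₄/12`, `g₃ = c₆/216`), let `u₁ : ℂ → W₁(ℂ)` (surjective, kernel `Λ₁`) and
`u₂ : ℂ → W₂(ℂ)` (kernel `Λ₂`) be uniformisations in the coordinates of the models,
`uᵢ(z) = (℘_{Λᵢ}(z) − b₂/12, (℘′_{Λᵢ}(z) − a₁x − a₃)/2)` off `Λᵢ`, and let `c ∈ ℚˣ` with
`cΛ₁ ⊆ Λ₂`.  Then there is an isogeny `φ : W₁ → W₂` over `ℚ` (the tree's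
`WeierstrassCurve.Isogeny`) such that, for the embedding `j : ℚ̄ → ℂ` of the scalar tower and
every `m ∈ W₁(ℚ̄)`, `z ∈ ℂ` with `j_* m = u₁(z)`: **`j_*(φ m) = u₂(cz)`**.  The construction
(descent of the transformation `℘_{c⁻¹Λ₂} = (P₀/Q₀)(℘_{Λ₁})` to `ℚ(X)`, the analytic map
`Φ = u₂ ∘ (c·) ∘ u₁⁻¹` preserving `j_* W₁(ℚ̄)`, algebraicity off a finite set,
`Γ_ℚ`-equivariance) is VERBATIM that of the tree's
`exists_isogeny_x_eq_of_forall_mul_mem_lattice` (`NeronIsogenyScalingProofs`), which chooses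
`u₁, u₂, j` internally and therefore cannot state this identity; here they are parameters and the
identity `j_* ∘ φ = Φ ∘ j_*` established on the way is the conclusion.
[cite: SilvermanAEC2009, Thm. VI.4.1] -/
theorem exists_isogeny_map_eq_uniformize_mul_of_forall_mul_mem_lattice
    {W₁ W₂ : WeierstrassCurve ℚ} [W₁.IsElliptic] {L₁ L₂ : PeriodPair}
    (h₁₂ : L₁.g₂ = (W₁.baseChange ℂ).c₄ / 12) (h₁₃ : L₁.g₃ = (W₁.baseChange ℂ).c₆ / 216)
    (h₂₂ : L₂.g₂ = (W₂.baseChange ℂ).c₄ / 12) (h₂₃ : L₂.g₃ = (W₂.baseChange ℂ).c₆ / 216)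
    {u₁ : ℂ →+ (W₁.baseChange ℂ).toAffine.Point} (hker₁ : (u₁.ker : Set ℂ) = L₁.lattice)
    (hsurj₁ : Function.Surjective u₁)
    (hu₁ : ∀ z ∉ L₁.lattice, ∃ hz, u₁ z = .some (℘[L₁] z - (W₁.baseChange ℂ).b₂ / 12)
        ((℘'[L₁] z - (W₁.baseChange ℂ).a₁ * (℘[L₁] z - (W₁.baseChange ℂ).b₂ / 12) -
          (W₁.baseChange ℂ).a₃) / 2) hz)
    {u₂ : ℂ →+ (W₂.baseChange ℂ).toAffine.Point} (hker₂ : (u₂.ker : Set ℂ) = L₂.lattice)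
    (hu₂ : ∀ z ∉ L₂.lattice, ∃ hz, u₂ z = .some (℘[L₂] z - (W₂.baseChange ℂ).b₂ / 12)
        ((℘'[L₂] z - (W₂.baseChange ℂ).a₁ * (℘[L₂] z - (W₂.baseChange ℂ).b₂ / 12) -
          (W₂.baseChange ℂ).a₃) / 2) hz)
    {c : ℚ} (hc : c ≠ 0) (hle : ∀ z ∈ L₁.lattice, (c : ℂ) * z ∈ L₂.lattice) :
    ∃ φ : Isogeny W₁ W₂, ∀ (m : W₁.geomPoints) (z : ℂ),
      Affine.Point.map (IsScalarTower.toAlgHom ℚ (AlgebraicClosure ℚ) ℂ) m = u₁ z →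
      Affine.Point.map (IsScalarTower.toAlgHom ℚ (AlgebraicClosure ℚ) ℂ) (φ m) =
        u₂ ((c : ℂ) * z) := by
  have hu₁0 : ∀ z, u₁ z = 0 ↔ z ∈ L₁.lattice := fun z ↦ by
    rw [← SetLike.mem_coe, ← hker₁, SetLike.mem_coe, AddMonoidHom.mem_ker]
  have hu₂0 : ∀ z, u₂ z = 0 ↔ z ∈ L₂.lattice := fun z ↦ by
    rw [← SetLike.mem_coe, ← hker₂, SetLike.mem_coe, AddMonoidHom.mem_ker]
  -- the lattice `Λ' = c⁻¹Λ₂ ⊇ Λ₁`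
  have hcC : (c : ℂ) ≠ 0 := by exact_mod_cast hc
  have hci : (c : ℂ)⁻¹ ≠ 0 := inv_ne_zero hcC
  set L' : PeriodPair := L₂.mulLeft ((c : ℂ)⁻¹) hci with hL'def
  have hL' : ∀ z, z ∈ L'.lattice ↔ (c : ℂ) * z ∈ L₂.lattice := fun z ↦ by
    rw [hL'def, PeriodPair.mem_mulLeft_lattice, inv_inv]
  have hLL' : L₁.lattice ≤ L'.lattice := fun z hz ↦ (hL' z).mpr (hle z hz)
  have h℘ : ∀ z, ℘[L₂] (c * z) = ((c : ℂ)⁻¹) ^ 2 * ℘[L'] z := fun z ↦ by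
    have h := PeriodPair.weierstrassP_mulLeft ((c : ℂ)⁻¹) hci L₂ (c * z)
    rw [inv_mul_cancel_left₀ hcC, ← hL'def] at h
    rw [h, ← mul_assoc, mul_inv_cancel₀ (pow_ne_zero 2 hci), one_mul]
  have h℘' : ∀ z, ℘'[L₂] (c * z) = ((c : ℂ)⁻¹) ^ 3 * ℘'[L'] z := fun z ↦ by
    have h := PeriodPair.derivWeierstrassP_mulLeft ((c : ℂ)⁻¹) hci L₂ (c * z)
    rw [inv_mul_cancel_left₀ hcC, ← hL'def] at h
    rw [h, ← mul_assoc, mul_inv_cancel₀ (pow_ne_zero 3 hci), one_mul]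
  -- the invariants are rational
  have hg₂ : ∃ q : ℚ, (q : ℂ) = L₁.g₂ :=
    ⟨W₁.c₄ / 12, by rw [h₁₂, WeierstrassCurve.baseChange, WeierstrassCurve.map_c₄, eq_ratCast]; push_cast; ring⟩
  have hg₃ : ∃ q : ℚ, (q : ℂ) = L₁.g₃ :=
    ⟨W₁.c₆ / 216, by rw [h₁₃, WeierstrassCurve.baseChange, WeierstrassCurve.map_c₆, eq_ratCast]; push_cast; ring⟩
  have hg₂' : ∃ q : ℚ, (q : ℂ) = L'.g₂ :=
    ⟨c ^ 4 * W₂.c₄ / 12, by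
      rw [hL'def, PeriodPair.g₂_mulLeft, h₂₂, WeierstrassCurve.baseChange, WeierstrassCurve.map_c₄,
        eq_ratCast, inv_pow, inv_inv]; push_cast; ring⟩
  have hg₃' : ∃ q : ℚ, (q : ℂ) = L'.g₃ :=
    ⟨c ^ 6 * W₂.c₆ / 216, by
      rw [hL'def, PeriodPair.g₃_mulLeft, h₂₃, WeierstrassCurve.baseChange, WeierstrassCurve.map_c₆,
        eq_ratCast, inv_pow, inv_inv]; push_cast; ring⟩
  -- the transformation `℘_{Λ'} = (P₀/Q₀)(℘_{Λ₁})` over `ℚ`, and its derivative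
  obtain ⟨P₀, Q₀, hQ₀m, -, hQ', hPQ'⟩ :=
    L₁.exists_rat_polynomial_weierstrassP_mul_eval_eq_of_le L' hLL' hg₂ hg₃ hg₂' hg₃'
  have hQ : ∀ z ∉ L'.lattice, aeval (℘[L₁] z) Q₀ ≠ 0 := fun z hz ↦ by
    rw [← eval_map_algebraMap]; exact hQ' z hz
  have hPQ : ∀ z ∉ L'.lattice, ℘[L'] z * aeval (℘[L₁] z) Q₀ = aeval (℘[L₁] z) P₀ := fun z hz ↦ by
    rw [← eval_map_algebraMap, ← eval_map_algebraMap]; exact hPQ' z hz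
  have hder : ∀ z ∉ L'.lattice, ℘'[L'] z * aeval (℘[L₁] z) Q₀ ^ 2 =
      ℘'[L₁] z * aeval (℘[L₁] z) (derivative P₀ * Q₀ - P₀ * derivative Q₀) := fun z hz ↦ by
    have h := L₁.derivWeierstrassP_mul_eval_sq_eq_of_le L' hLL' hPQ' hz
    rw [Polynomial.derivative_map, Polynomial.derivative_map, ← Polynomial.map_mul,
      ← Polynomial.map_mul, ← Polynomial.map_sub, eval_map_algebraMap, eval_map_algebraMap] at h
    exact h
  -- freeze the numerator of the derivative of the transformation
  set N₀ : ℚ[X] := derivative P₀ * Q₀ - P₀ * derivative Q₀ with hN₀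
  -- the embedding `j : ℚ̄ → ℂ` of the scalar tower and the induced injections on points
  set j : (AlgebraicClosure ℚ) →ₐ[ℚ] ℂ := IsScalarTower.toAlgHom ℚ (AlgebraicClosure ℚ) ℂ with hjdef
  set jW₁ := (Affine.Point.map (W' := W₁) j : W₁.geomPoints →+ (W₁.baseChange ℂ).toAffine.Point)
    with hjW₁
  set jW₂ := (Affine.Point.map (W' := W₂) j : W₂.geomPoints →+ (W₂.baseChange ℂ).toAffine.Point)
    with hjW₂
  have hj₁ : Function.Injective jW₁ := Affine.Point.map_injective (W' := W₁) j
  have hj₂ : Function.Injective jW₂ := Affine.Point.map_injective (W' := W₂) j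
  -- the analytic isogeny `Φ : W₁(ℂ) → W₂(ℂ)`, `u₁ z ↦ u₂ (cz)`
  obtain ⟨Φ, hΦ⟩ : ∃ Φ : (W₁.baseChange ℂ).toAffine.Point →+ (W₂.baseChange ℂ).toAffine.Point,
      ∀ z, Φ (u₁ z) = u₂ (c * z) := by
    refine exists_addMonoidHom_apply_eq u₁ hsurj₁ (u₂.comp (AddMonoidHom.mulLeft (c : ℂ)))
      fun z hz ↦ ?_
    rw [AddMonoidHom.coe_comp, Function.comp_apply, AddMonoidHom.coe_mulLeft, hu₂0]
    exact hle z ((hu₁0 z).mp hz)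
  -- representatives of `Λ'/Λ₁` and the finite exceptional set
  obtain ⟨S, hS0, -, hS, -⟩ := L₁.exists_finset_representatives L' hLL'
  have hkerΦ : ∀ z, Φ (u₁ z) = 0 → u₁ z ∈ u₁ '' (S : Set ℂ) := by
    intro z hz
    rw [hΦ, hu₂0, ← hL'] at hz
    obtain ⟨s, hs, hzs⟩ := (hS z).mp hz
    refine ⟨s, hs, ?_⟩
    have h0 : u₁ (z - s) = 0 := (hu₁0 _).mpr hzs
    rwa [map_sub, sub_eq_zero, eq_comm] at h0
  set β₁ : (AlgebraicClosure ℚ) := algebraMap ℚ (AlgebraicClosure ℚ) W₁.b₂ / 12 with hβ₁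
  set Bad : Set W₁.geomPoints := {m | jW₁ m ∈ u₁ '' (S : Set ℂ)} ∪
    {m | ∃ (x y : (AlgebraicClosure ℚ)) (h : (W₁.baseChange (AlgebraicClosure ℚ)).toAffine.Nonsingular x y),
      m = .some x y h ∧ ((Q₀.map (algebraMap ℚ (AlgebraicClosure ℚ))).comp (X + C β₁)).eval x = 0} with hBad
  have hBadfin : Bad.Finite := by
    refine Set.Finite.union ?_ ?_
    · exact (S.finite_toSet.image u₁).preimage hj₁.injOn
    · refine finite_setOf_eval_x_eq_zero W₁ (Monic.ne_zero ?_)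
      exact (hQ₀m.map _).comp (monic_X_add_C β₁) (by rw [natDegree_X_add_C]; exact one_ne_zero)
  have hevalQ : ∀ x : (AlgebraicClosure ℚ), ((Q₀.map (algebraMap ℚ (AlgebraicClosure ℚ))).comp (X + C β₁)).eval x = aeval (x + β₁) Q₀ := by
    intro x
    rw [eval_comp, eval_add, eval_X, eval_C, eval_map_algebraMap]
  -- good points: affine, `Q₀(x + β₁) ≠ 0`, and `j m = u₁ z` with `z ∉ Λ'`
  have hgood : ∀ m : W₁.geomPoints, m ∉ Bad → ∃ (x y : (AlgebraicClosure ℚ))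
      (h : (W₁.baseChange (AlgebraicClosure ℚ)).toAffine.Nonsingular x y), m = .some x y h ∧
      aeval (x + β₁) Q₀ ≠ 0 ∧ ∃ z, z ∉ L'.lattice ∧ jW₁ m = u₁ z := by
    intro m hm
    simp only [hBad, Set.mem_union, Set.mem_setOf_eq, not_or, not_exists, not_and] at hm
    obtain ⟨z, hz⟩ := hsurj₁ (jW₁ m)
    have hzL' : z ∉ L'.lattice := by
      intro hzm
      obtain ⟨s, hs, hzs⟩ := (hS z).mp hzm
      apply hm.1
      refine ⟨s, hs, ?_⟩
      have h0 : u₁ (z - s) = 0 := (hu₁0 _).mpr hzs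
      rw [map_sub, sub_eq_zero] at h0
      rw [← hz, h0]
    rcases m with _ | ⟨x, y, h⟩
    · exfalso
      apply hm.1
      refine ⟨0, hS0, ?_⟩
      rw [map_zero]
      exact (map_zero jW₁).symm
    · refine ⟨x, y, h, rfl, ?_, z, hzL', hz.symm⟩
      rw [← hevalQ]
      exact hm.2 x y h rfl
  -- the `ℚ̄`-rational formula for `Φ` at good points
  have hformula : ∀ {x y : (AlgebraicClosure ℚ)} (hxy : (W₁.baseChange (AlgebraicClosure ℚ)).toAffine.Nonsingular x y) {z : ℂ},
      z ∉ L'.lattice → jW₁ (.some x y hxy) = u₁ z →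
      ∃ h₂ : (W₂.baseChange (AlgebraicClosure ℚ)).toAffine.Nonsingular
        (((algebraMap ℚ (AlgebraicClosure ℚ) c)⁻¹ ^ 2 * aeval (x + algebraMap ℚ (AlgebraicClosure ℚ) W₁.b₂ / 12) P₀ -
            algebraMap ℚ (AlgebraicClosure ℚ) W₂.b₂ / 12 * aeval (x + algebraMap ℚ (AlgebraicClosure ℚ) W₁.b₂ / 12) Q₀) /
          aeval (x + algebraMap ℚ (AlgebraicClosure ℚ) W₁.b₂ / 12) Q₀)
        (((algebraMap ℚ (AlgebraicClosure ℚ) c)⁻¹ ^ 3 *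
              aeval (x + algebraMap ℚ (AlgebraicClosure ℚ) W₁.b₂ / 12) N₀ *
              (2 * y + algebraMap ℚ (AlgebraicClosure ℚ) W₁.a₁ * x + algebraMap ℚ (AlgebraicClosure ℚ) W₁.a₃) -
            algebraMap ℚ (AlgebraicClosure ℚ) W₂.a₁ *
              ((algebraMap ℚ (AlgebraicClosure ℚ) c)⁻¹ ^ 2 * aeval (x + algebraMap ℚ (AlgebraicClosure ℚ) W₁.b₂ / 12) P₀ -
                algebraMap ℚ (AlgebraicClosure ℚ) W₂.b₂ / 12 * aeval (x + algebraMap ℚ (AlgebraicClosure ℚ) W₁.b₂ / 12) Q₀) *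
              aeval (x + algebraMap ℚ (AlgebraicClosure ℚ) W₁.b₂ / 12) Q₀ -
            algebraMap ℚ (AlgebraicClosure ℚ) W₂.a₃ * aeval (x + algebraMap ℚ (AlgebraicClosure ℚ) W₁.b₂ / 12) Q₀ ^ 2) /
          (2 * aeval (x + algebraMap ℚ (AlgebraicClosure ℚ) W₁.b₂ / 12) Q₀ ^ 2)),
      jW₂ (.some _ _ h₂) = Φ (jW₁ (.some x y hxy)) := by
    intro x y hxy z hzL' hz
    obtain ⟨h₂, hh₂⟩ := map_some_eq_uniformize_mul_of_transformation j hu₁ hu₂ hle hL' h℘ h℘'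
      hQ hPQ hder hxy hzL' hz
    exact ⟨h₂, by rw [hz, hΦ]; exact hh₂⟩
  -- `Φ` preserves `j(W₁(ℚ̄))`
  have hpres : ∀ m : W₁.geomPoints, Φ (jW₁ m) ∈ jW₂.range := by
    set T : AddSubgroup W₁.geomPoints := (jW₂.range.comap Φ).comap jW₁ with hT
    have hTtop : T = ⊤ := by
      refine AddSubgroup.eq_top_of_finite_compl T (hBadfin.subset fun m hm ↦ ?_)
      by_contra hmB
      apply hm
      obtain ⟨x, y, h, rfl, -, z, hzL', hz⟩ := hgood m hmB
      obtain ⟨h₂, hm₂⟩ := hformula h hzL' hz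
      rw [hT, SetLike.mem_coe, AddSubgroup.mem_comap, AddSubgroup.mem_comap]
      exact ⟨_, hm₂⟩
    intro m
    have : m ∈ T := by rw [hTtop]; exact AddSubgroup.mem_top m
    rw [hT, AddSubgroup.mem_comap, AddSubgroup.mem_comap] at this
    exact this
  -- the restriction `φ` of `Φ` along `j`
  set eR : W₂.geomPoints ≃+ jW₂.range := AddMonoidHom.ofInjective hj₂ with heR
  set φ : W₁.geomPoints →+ W₂.geomPoints :=
    eR.symm.toAddMonoidHom.comp ((Φ.comp jW₁).codRestrict jW₂.range fun m ↦ hpres m) with hφ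
  have hfφ : ∀ m, jW₂ (φ m) = Φ (jW₁ m) := by
    intro m
    have h1 : ((eR (φ m) : jW₂.range) : (W₂.baseChange ℂ).toAffine.Point) = jW₂ (φ m) :=
      AddMonoidHom.ofInjective_apply hj₂
    rw [← h1, hφ, AddMonoidHom.coe_comp, Function.comp_apply, AddEquiv.coe_toAddMonoidHom,
      AddEquiv.apply_symm_apply]
    rfl
  -- the value of `φ` at a good point
  have hφval : ∀ {x y : (AlgebraicClosure ℚ)} (hxy : (W₁.baseChange (AlgebraicClosure ℚ)).toAffine.Nonsingular x y) {z : ℂ},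
      z ∉ L'.lattice → jW₁ (.some x y hxy) = u₁ z → ∃ h₂, φ (.some x y hxy) = .some
        (((algebraMap ℚ (AlgebraicClosure ℚ) c)⁻¹ ^ 2 * aeval (x + algebraMap ℚ (AlgebraicClosure ℚ) W₁.b₂ / 12) P₀ -
            algebraMap ℚ (AlgebraicClosure ℚ) W₂.b₂ / 12 * aeval (x + algebraMap ℚ (AlgebraicClosure ℚ) W₁.b₂ / 12) Q₀) /
          aeval (x + algebraMap ℚ (AlgebraicClosure ℚ) W₁.b₂ / 12) Q₀)
        (((algebraMap ℚ (AlgebraicClosure ℚ) c)⁻¹ ^ 3 *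
              aeval (x + algebraMap ℚ (AlgebraicClosure ℚ) W₁.b₂ / 12) N₀ *
              (2 * y + algebraMap ℚ (AlgebraicClosure ℚ) W₁.a₁ * x + algebraMap ℚ (AlgebraicClosure ℚ) W₁.a₃) -
            algebraMap ℚ (AlgebraicClosure ℚ) W₂.a₁ *
              ((algebraMap ℚ (AlgebraicClosure ℚ) c)⁻¹ ^ 2 * aeval (x + algebraMap ℚ (AlgebraicClosure ℚ) W₁.b₂ / 12) P₀ -
                algebraMap ℚ (AlgebraicClosure ℚ) W₂.b₂ / 12 * aeval (x + algebraMap ℚ (AlgebraicClosure ℚ) W₁.b₂ / 12) Q₀) *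
              aeval (x + algebraMap ℚ (AlgebraicClosure ℚ) W₁.b₂ / 12) Q₀ -
            algebraMap ℚ (AlgebraicClosure ℚ) W₂.a₃ * aeval (x + algebraMap ℚ (AlgebraicClosure ℚ) W₁.b₂ / 12) Q₀ ^ 2) /
          (2 * aeval (x + algebraMap ℚ (AlgebraicClosure ℚ) W₁.b₂ / 12) Q₀ ^ 2)) h₂ := by
    intro x y hxy z hzL' hz
    obtain ⟨h₂, hm₂⟩ := hformula hxy hzL' hz
    exact ⟨h₂, hj₂ (by rw [hfφ, hm₂])⟩
  -- `φ` is algebraic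
  have halg : IsAlgebraicOn W₁ W₂ φ := by
    set Tm : MvPolynomial (Fin 2) (AlgebraicClosure ℚ) := MvPolynomial.X 0 + MvPolynomial.C β₁ with hTm
    set κ : (AlgebraicClosure ℚ) := (algebraMap ℚ (AlgebraicClosure ℚ) c)⁻¹ with hκ
    set Pm : MvPolynomial (Fin 2) (AlgebraicClosure ℚ) := MvPolynomial.C (κ ^ 2) * Polynomial.aeval Tm P₀ -
      MvPolynomial.C (algebraMap ℚ (AlgebraicClosure ℚ) W₂.b₂ / 12) * Polynomial.aeval Tm Q₀ with hPm
    refine ⟨Pm, Polynomial.aeval Tm Q₀,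
      MvPolynomial.C (κ ^ 3) * Polynomial.aeval Tm N₀ *
          (MvPolynomial.C 2 * MvPolynomial.X 1 + MvPolynomial.C (algebraMap ℚ (AlgebraicClosure ℚ) W₁.a₁) *
            MvPolynomial.X 0 + MvPolynomial.C (algebraMap ℚ (AlgebraicClosure ℚ) W₁.a₃)) -
        MvPolynomial.C (algebraMap ℚ (AlgebraicClosure ℚ) W₂.a₁) * Pm * Polynomial.aeval Tm Q₀ -
        MvPolynomial.C (algebraMap ℚ (AlgebraicClosure ℚ) W₂.a₃) * Polynomial.aeval Tm Q₀ ^ 2,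
      MvPolynomial.C 2 * Polynomial.aeval Tm Q₀ ^ 2, hBadfin.subset fun m hm ↦ ?_⟩
    by_contra hmB
    apply hm
    obtain ⟨x, y, h, rfl, hQx, z, hzL', hz⟩ := hgood m hmB
    obtain ⟨h₂, hφm⟩ := hφval h hzL' hz
    have heQ : MvPolynomial.eval ![x, y] (Polynomial.aeval Tm Q₀) = aeval (x + β₁) Q₀ :=
      eval_aeval_X_zero_add_C Q₀ β₁ x y
    have heP : MvPolynomial.eval ![x, y] (Polynomial.aeval Tm P₀) = aeval (x + β₁) P₀ :=
      eval_aeval_X_zero_add_C P₀ β₁ x y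
    have heN : MvPolynomial.eval ![x, y] (Polynomial.aeval Tm N₀) =
        aeval (x + β₁) N₀ :=
      eval_aeval_X_zero_add_C _ β₁ x y
    refine ⟨x, y, h, rfl, ?_, ?_, ?_⟩
    · rw [heQ]; exact hQx
    · simp only [map_mul, map_pow, MvPolynomial.eval_C, heQ]
      exact mul_ne_zero two_ne_zero (pow_ne_zero 2 hQx)
    · have hx₂ : MvPolynomial.eval ![x, y] Pm / MvPolynomial.eval ![x, y] (Polynomial.aeval Tm Q₀) =
          ((algebraMap ℚ (AlgebraicClosure ℚ) c)⁻¹ ^ 2 * aeval (x + algebraMap ℚ (AlgebraicClosure ℚ) W₁.b₂ / 12) P₀ -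
            algebraMap ℚ (AlgebraicClosure ℚ) W₂.b₂ / 12 * aeval (x + algebraMap ℚ (AlgebraicClosure ℚ) W₁.b₂ / 12) Q₀) /
          aeval (x + algebraMap ℚ (AlgebraicClosure ℚ) W₁.b₂ / 12) Q₀ := by
        simp only [hPm, map_sub, map_mul, MvPolynomial.eval_C, heQ, heP, hκ, hβ₁]
      have hy₂ : MvPolynomial.eval ![x, y]
            (MvPolynomial.C (κ ^ 3) * Polynomial.aeval Tm N₀ *
              (MvPolynomial.C 2 * MvPolynomial.X 1 + MvPolynomial.C (algebraMap ℚ (AlgebraicClosure ℚ) W₁.a₁) *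
                MvPolynomial.X 0 + MvPolynomial.C (algebraMap ℚ (AlgebraicClosure ℚ) W₁.a₃)) -
            MvPolynomial.C (algebraMap ℚ (AlgebraicClosure ℚ) W₂.a₁) * Pm * Polynomial.aeval Tm Q₀ -
            MvPolynomial.C (algebraMap ℚ (AlgebraicClosure ℚ) W₂.a₃) * Polynomial.aeval Tm Q₀ ^ 2) /
          MvPolynomial.eval ![x, y] (MvPolynomial.C 2 * Polynomial.aeval Tm Q₀ ^ 2) =
          ((algebraMap ℚ (AlgebraicClosure ℚ) c)⁻¹ ^ 3 *
              aeval (x + algebraMap ℚ (AlgebraicClosure ℚ) W₁.b₂ / 12) N₀ *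
              (2 * y + algebraMap ℚ (AlgebraicClosure ℚ) W₁.a₁ * x + algebraMap ℚ (AlgebraicClosure ℚ) W₁.a₃) -
            algebraMap ℚ (AlgebraicClosure ℚ) W₂.a₁ *
              ((algebraMap ℚ (AlgebraicClosure ℚ) c)⁻¹ ^ 2 * aeval (x + algebraMap ℚ (AlgebraicClosure ℚ) W₁.b₂ / 12) P₀ -
                algebraMap ℚ (AlgebraicClosure ℚ) W₂.b₂ / 12 * aeval (x + algebraMap ℚ (AlgebraicClosure ℚ) W₁.b₂ / 12) Q₀) *
              aeval (x + algebraMap ℚ (AlgebraicClosure ℚ) W₁.b₂ / 12) Q₀ -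
            algebraMap ℚ (AlgebraicClosure ℚ) W₂.a₃ * aeval (x + algebraMap ℚ (AlgebraicClosure ℚ) W₁.b₂ / 12) Q₀ ^ 2) /
          (2 * aeval (x + algebraMap ℚ (AlgebraicClosure ℚ) W₁.b₂ / 12) Q₀ ^ 2) := by
        simp only [hPm, map_sub, map_mul, map_add, map_pow, MvPolynomial.eval_C, MvPolynomial.eval_X,
          heQ, heP, heN, hκ, hβ₁, Matrix.cons_val_zero, Matrix.cons_val_one]
      refine ⟨by rw [hx₂, hy₂]; exact h₂, ?_⟩
      rw [hφm]
      exact Affine.Point.some.congr_simp _ _ hx₂.symm _ _ hy₂.symm _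
  -- `φ` commutes with the Galois group
  have hequiv : ∀ (τ : Field.absoluteGaloisGroup ℚ) (P : W₁.geomPoints), φ (τ • P) = τ • φ P := by
    intro τ
    -- `τ` as an algebra endomorphism of `ℚ̄`, and its action on points
    let τ' : (AlgebraicClosure ℚ) ≃ₐ[ℚ] (AlgebraicClosure ℚ) := τ
    set τₕ : (AlgebraicClosure ℚ) →ₐ[ℚ] (AlgebraicClosure ℚ) := (τ' : (AlgebraicClosure ℚ) →ₐ[ℚ] (AlgebraicClosure ℚ)) with hτₕ
    have hτinj' : Function.Injective τₕ := fun a b hab ↦ τ'.injective hab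
    have hsmul₂ : ∀ P : W₂.geomPoints, τ • P = Affine.Point.map τₕ P := fun _ ↦ rfl
    -- the two homomorphisms `P ↦ φ (τ P)` and `P ↦ τ (φ P)` agree off a finite set
    have hτinj : Function.Injective (fun P : W₁.geomPoints ↦ τ • P) := MulAction.injective τ
    have hfin : (Bad ∪ (fun P : W₁.geomPoints ↦ τ • P) ⁻¹' Bad).Finite :=
      hBadfin.union (hBadfin.preimage hτinj.injOn)
    have heq : φ.comp (DistribSMul.toAddMonoidHom W₁.geomPoints τ) =
        (DistribSMul.toAddMonoidHom W₂.geomPoints τ).comp φ := by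
      refine AddMonoidHom.eq_of_eqOn_compl_finite hfin fun P hP ↦ ?_
      simp only [Set.mem_union, Set.mem_preimage, not_or] at hP
      obtain ⟨x, y, h, rfl, -, z, hzL', hz⟩ := hgood P hP.1
      obtain ⟨x', y', h', hP', -, z', hzL'', hz'⟩ := hgood _ hP.2
      have hns : (W₁.baseChange (AlgebraicClosure ℚ)).toAffine.Nonsingular (τₕ x) (τₕ y) :=
        (W₁.toAffine.baseChange_nonsingular hτinj' x y).mpr h
      have hτP : τ • (show W₁.geomPoints from Affine.Point.some x y h) =
          (show W₁.geomPoints from Affine.Point.some (τₕ x) (τₕ y) hns) := rfl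
      rw [hτP] at hP' hz'
      obtain ⟨hx', hy'⟩ := Affine.Point.some.inj hP'
      subst hx' hy'
      obtain ⟨h₂, hφP⟩ := hφval h hzL' hz
      obtain ⟨h₂', hφP'⟩ := hφval hns hzL'' hz'
      show φ (τ • (show W₁.geomPoints from Affine.Point.some x y h)) =
        τ • φ (show W₁.geomPoints from Affine.Point.some x y h)
      rw [hτP, hφP', hφP, hsmul₂]
      erw [Affine.Point.map_some]
      refine Affine.Point.some.congr_simp _ _ ?_ _ _ ?_ _
      · simp only [map_div₀, map_sub, map_mul, map_add, map_pow, map_inv₀, map_ofNat,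
          AlgHom.commutes, ← Polynomial.aeval_algHom_apply]
      · simp only [map_div₀, map_sub, map_mul, map_add, map_pow, map_inv₀, map_ofNat,
          AlgHom.commutes, ← Polynomial.aeval_algHom_apply]
    intro P
    exact congrArg (fun g : W₁.geomPoints →+ W₂.geomPoints ↦ g P) heq
  -- the isogeny, and the `x`-coordinate formula repackaged over `ℚ[X]`
  let ψ : Isogeny W₁ W₂ :=
    { toAddMonoidHom := φ
      isAlgebraic := halg
      equivariant := hequiv
      finite_ker := halg.finite_ker }
  refine ⟨ψ, fun m z hm ↦ ?_⟩
  change jW₂ (φ m) = u₂ ((c : ℂ) * z)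
  rw [hfφ, show jW₁ m = u₁ z from hm, hΦ]

end Literature.NumberTheory.EllipticCurves

end
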